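import Summits.QuantumFields.YangMills.Theorems.SwapVirialDeficitSectorLaplaceMbDensityFloorDetRescaled
import Summits.QuantumFields.YangMills.Theorems.SwapVirialDeficitSectorLaplaceMbDensityComparable
import HarnessLib

/-!
# Route `SwapVirialDeficit` (YangMills): THE POINTWISE TIP∕SHELL COMPARABILITY IN RESCALED LETTERS, UNIFORM OFF THE CORNER DISC —
# `𝔪(hubAt δ_t 1, ε, p) ≤ R_L(ρ₀)·(1 + δ_t²)·𝔪(hubAt δ_s 1, ε, p)` for ALL `|p| ≥ ρ₀` (the gnomonic ends included)
# (cell ym-idea-1, skeleton ➎, `stub_core_tip`: the pointwise hypothesis of the δ-integration layer on the box `{ρ₀² ≤ |p|²}`;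
# free-hands support of ⟨stmt-QuantumFields-24197⟩ `SwapVirialDeficit.SwapGluedStiffness`)

The unscaled comparability ✓`mbDensity_hubAt_comparable` carries `R(p) ∝ (1+x₀²)²(1+y₀²)²∕|p|²`, useless at the gnomonic ends.  In w2 g59's rescaled letters both sides carry
the SAME integrable weight `ρ(gnoBase p)(1+x₀²)(1+y₀²) = (1+x₀²)⁻¹(1+y₀²)⁻¹`: the tip ceiling ✓`mbDensity_angUnit_le_floorDet_rescaled` (w2 g61; ONE soft pair, its
`det M′ = s²[c²s² + c²x₀²∕(1+x₀²) + y₀²∕(1+y₀²)]∕(1800L⁶)² ≥ s²c²·(ρ₀²∕(1+ρ₀²))∕(1800L⁶)²` for `|p| ≥ ρ₀`, ★`floorDetRescaled_ge`) against the ISOTROPIC shell floor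
✓`mbDensity_ge_detFol_rescaled'` (w2 g60; no soft pair needed on the shell side — the shell only has to be of order `1`, the tip's `(1+δ_t²)` is what the `δ`-weight
`((1+δ²)⁻¹)²` integrates to the `√τ`-rate), with the follower one-loop matching ✓`abs_log_det_gnoFolHessian_sub_le_joint` ∕ ✓`gnoFolHessian_coercive_base` as in the unscaled file:
★★★ `mbDensity_hubAt_comparable_rescaled` — for good `ε`, `1 ≤ δ_r ≤ δ_s, δ_t` in the matching window `122689728·δ_r⁻¹·L⁴ ≤ μ_F∕(2·3|Fol L|)`, `0 < ρ₀`, `ρ₀² ≤ |p|²`: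
`𝔪(hubAt δ_t 1, ε, p) ≤ [e·((1+d)·20400L⁴)^{7∕2}·(√(¼(1800L⁶)⁻¹)³)⁻¹·(1800L⁶)²·2(1+ρ₀²)∕ρ₀²]·(1+δ_t²)·𝔪(hubAt δ_s 1, ε, p)` — `R` INDEPENDENT of `p`.

HONEST LABEL: algebra on landed bricks; the δ-integration with this weight, the corner disc `|p| < ρ₀`, tip-core and the assembly of `stub_core_tip`, ⟨24197⟩ ∕ ⟨24194⟩ remain
OPEN; own crux ⟨22884⟩ `LargeFieldMassRefinementTail` OPEN (blocked-on ⟨19935⟩); the Yang–Mills mass gap is NOT proved; no summit is proved by a line.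
THEOREMS ONLY (0 `def`, 0 `sorry`, no instance), standard axioms.  Width seat ym-line-sfw-p2-w2 g61 (cell ym-idea-1, free hands), `--supports stmt-QuantumFields-24197`.
References: [cite: Luscher1983, §2]; [cite: Breitung1994, Lemma 26]; [folklore].
-/

set_option autoImplicit false
set_option synthInstance.maxSize 1024

noncomputable section

open MeasureTheory Quaternion Set Module
open scoped Quaternion BigOperators ENNReal InnerProductSpace
open Literature.MathematicalPhysics.QuantumLattice
open Literature.MathematicalPhysics.QuantumFieldTheory hiding SU2

namespace Summit.QuantumFields.YangMills.Theorems.SwapVirialDeficit.SectorLaplace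

open Summit.QuantumFields.YangMills.Theorems.FemtoTransferGap
open Summit.QuantumFields.YangMills.Theorems.FemtoTransferGap.TT
open Summit.QuantumFields.YangMills.Theorems.VirialFluxGap.RingDeficit
open Summit.QuantumFields.YangMills.Theorems.SwapVirialDeficit.SwapRing
open Summit.QuantumFields.YangMills.Theorems.SwapVirialDeficit.BlowUpRing

variable {L : ℕ} [NeZero L]

omit [NeZero L] in
/-- `t ↦ t/(1+t)` bookkeeping of the base point: `ρ₀²∕(1+ρ₀²) ≤ x₀²∕(1+x₀²) + y₀²∕(1+y₀²)` whenever `ρ₀² ≤ x₀² + y₀²`. [folklore] -/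
theorem softPair_base_ge {ρ₀ : ℝ} (p : ℝ × ℝ) (hp : ρ₀ ^ 2 ≤ p.1 ^ 2 + p.2 ^ 2) :
    ρ₀ ^ 2 / (1 + ρ₀ ^ 2) ≤ p.1 ^ 2 / (1 + p.1 ^ 2) + p.2 ^ 2 / (1 + p.2 ^ 2) := by
  have h1 : p.1 ^ 2 / (1 + (p.1 ^ 2 + p.2 ^ 2)) ≤ p.1 ^ 2 / (1 + p.1 ^ 2) :=
    div_le_div_of_nonneg_left (sq_nonneg _) (by positivity) (by nlinarith [sq_nonneg p.2])
  have h2 : p.2 ^ 2 / (1 + (p.1 ^ 2 + p.2 ^ 2)) ≤ p.2 ^ 2 / (1 + p.2 ^ 2) :=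
    div_le_div_of_nonneg_left (sq_nonneg _) (by positivity) (by nlinarith [sq_nonneg p.1])
  have h3 : ρ₀ ^ 2 / (1 + ρ₀ ^ 2) ≤ (p.1 ^ 2 + p.2 ^ 2) / (1 + (p.1 ^ 2 + p.2 ^ 2)) := by
    rw [div_le_div_iff₀ (by positivity) (by positivity)]
    nlinarith [sq_nonneg ρ₀]
  have h4 : (p.1 ^ 2 + p.2 ^ 2) / (1 + (p.1 ^ 2 + p.2 ^ 2)) = p.1 ^ 2 / (1 + (p.1 ^ 2 + p.2 ^ 2)) + p.2 ^ 2 / (1 + (p.1 ^ 2 + p.2 ^ 2)) := by ring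
  linarith

/-- ★ **THE RESCALED STRUCTURED-FLOOR DETERMINANT IS BOUNDED BELOW UNIFORMLY OFF THE CORNER DISC**: the `det M′` of ✓`mbDensity_angUnit_le_floorDet_rescaled` satisfies
`cos²θ·sin²θ·(ρ₀²∕(1+ρ₀²))∕(1800L⁶)² ≤ det M′(θ, p)` for `ρ₀² ≤ |p|²`. [folklore] -/
theorem floorDetRescaled_ge (θ : ℝ) {ρ₀ : ℝ} (p : ℝ × ℝ) (hp : ρ₀ ^ 2 ≤ p.1 ^ 2 + p.2 ^ 2) :
    Real.cos θ ^ 2 * Real.sin θ ^ 2 * (ρ₀ ^ 2 / (1 + ρ₀ ^ 2)) / (1800 * (L : ℝ) ^ 6) ^ 2 ≤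
      ((1 / 4 : ℝ) * (16 * Real.cos θ ^ 2 * Real.sin θ ^ 2 / ((7200 * (L : ℝ) ^ 6) * (1 + p.1 ^ 2))) * Real.sqrt (1 + p.1 ^ 2) ^ 2) *
          ((1 / 4 : ℝ) * (4 * Real.sin θ ^ 2 / ((1800 * (L : ℝ) ^ 6) * (1 + p.2 ^ 2))) * Real.sqrt (1 + p.2 ^ 2) ^ 2) +
        ((1 / 4 : ℝ) * (4 / ((1800 * (L : ℝ) ^ 6) * ((1 + p.1 ^ 2) * (1 + p.2 ^ 2))))) *
          (((1 / 4 : ℝ) * (16 * Real.cos θ ^ 2 * Real.sin θ ^ 2 / ((7200 * (L : ℝ) ^ 6) * (1 + p.1 ^ 2))) * Real.sqrt (1 + p.1 ^ 2) ^ 2) *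
              (p.1 * Real.sqrt (1 + p.2 ^ 2)) ^ 2 +
            ((1 / 4 : ℝ) * (4 * Real.sin θ ^ 2 / ((1800 * (L : ℝ) ^ 6) * (1 + p.2 ^ 2))) * Real.sqrt (1 + p.2 ^ 2) ^ 2) *
              (Real.sqrt (1 + p.1 ^ 2) * p.2) ^ 2) := by
  have hL : (0 : ℝ) < (L : ℝ) := Nat.cast_pos.2 (Nat.pos_of_ne_zero (NeZero.ne L))
  have hX1 : Real.sqrt (1 + p.1 ^ 2) ^ 2 = 1 + p.1 ^ 2 := Real.sq_sqrt (by positivity)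
  have hY1 : Real.sqrt (1 + p.2 ^ 2) ^ 2 = 1 + p.2 ^ 2 := Real.sq_sqrt (by positivity)
  have hp1 : (p.1 * Real.sqrt (1 + p.2 ^ 2)) ^ 2 = p.1 ^ 2 * (1 + p.2 ^ 2) := by rw [mul_pow, hY1]
  have hp2 : (Real.sqrt (1 + p.1 ^ 2) * p.2) ^ 2 = (1 + p.1 ^ 2) * p.2 ^ 2 := by rw [mul_pow, hX1]
  rw [hp1, hp2, hX1, hY1]
  set c2 : ℝ := Real.cos θ ^ 2 with hc2
  set s2 : ℝ := Real.sin θ ^ 2 with hs2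
  set X : ℝ := 1 + p.1 ^ 2 with hX
  set Y : ℝ := 1 + p.2 ^ 2 with hY
  set K : ℝ := 1800 * (L : ℝ) ^ 6 with hK
  have hc0 : 0 ≤ c2 := sq_nonneg _
  have hs0 : 0 ≤ s2 := sq_nonneg _
  have hc1 : c2 ≤ 1 := by rw [hc2]; nlinarith [Real.cos_sq_add_sin_sq θ, sq_nonneg (Real.sin θ)]
  have hX0 : 0 < X := by rw [hX]; positivity
  have hY0 : 0 < Y := by rw [hY]; positivity
  have hK0 : 0 < K := by rw [hK]; positivity
  -- normal form: `det M′ = s2/K²·(c2 s2 + c2 x₀²/X + y₀²/Y)`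
  have e : ((1 / 4 : ℝ) * (16 * c2 * s2 / ((7200 * (L : ℝ) ^ 6) * X)) * X) * ((1 / 4 : ℝ) * (4 * s2 / (K * Y)) * Y) +
      ((1 / 4 : ℝ) * (4 / (K * (X * Y)))) * (((1 / 4 : ℝ) * (16 * c2 * s2 / ((7200 * (L : ℝ) ^ 6) * X)) * X) * (p.1 ^ 2 * Y) +
        ((1 / 4 : ℝ) * (4 * s2 / (K * Y)) * Y) * (X * p.2 ^ 2)) =
      s2 / K ^ 2 * (c2 * s2 + c2 * p.1 ^ 2 / X + p.2 ^ 2 / Y) := by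
    rw [hK]; field_simp; ring
  rw [e]
  have hbase := softPair_base_ge p hp
  rw [← hX, ← hY] at hbase
  have h1 : c2 * (ρ₀ ^ 2 / (1 + ρ₀ ^ 2)) ≤ c2 * s2 + c2 * p.1 ^ 2 / X + p.2 ^ 2 / Y := by
    have ha : c2 * (p.2 ^ 2 / Y) ≤ p.2 ^ 2 / Y := by
      calc c2 * (p.2 ^ 2 / Y) ≤ 1 * (p.2 ^ 2 / Y) := by gcongr
        _ = p.2 ^ 2 / Y := one_mul _
    calc c2 * (ρ₀ ^ 2 / (1 + ρ₀ ^ 2)) ≤ c2 * (p.1 ^ 2 / X + p.2 ^ 2 / Y) := mul_le_mul_of_nonneg_left hbase hc0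
      _ = c2 * p.1 ^ 2 / X + c2 * (p.2 ^ 2 / Y) := by ring
      _ ≤ c2 * s2 + c2 * p.1 ^ 2 / X + p.2 ^ 2 / Y := by nlinarith [mul_nonneg hc0 hs0]
  calc c2 * s2 * (ρ₀ ^ 2 / (1 + ρ₀ ^ 2)) / K ^ 2 = s2 / K ^ 2 * (c2 * (ρ₀ ^ 2 / (1 + ρ₀ ^ 2))) := by ring
    _ ≤ s2 / K ^ 2 * (c2 * s2 + c2 * p.1 ^ 2 / X + p.2 ^ 2 / Y) := mul_le_mul_of_nonneg_left h1 (by positivity)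

set_option maxHeartbeats 1600000 in
/-- ★★★ **THE POINTWISE TIP∕SHELL COMPARABILITY IN RESCALED LETTERS, UNIFORM OFF THE CORNER DISC.**  Good signs, `1 ≤ δ_r ≤ δ_s, δ_t`, matching window
`122689728·δ_r⁻¹·L⁴ ≤ μ_F∕(2·3|Fol L|)`, `0 < ρ₀`, `ρ₀² ≤ |p|²`.  Then `𝔪(hubAt δ_t 1, ε, p) ≤ R_L(ρ₀)·(1 + δ_t²)·𝔪(hubAt δ_s 1, ε, p)` with the `p`-INDEPENDENT
`R_L(ρ₀) = e·((1+d)·20400L⁴)^{7∕2}·(√(¼(1800L⁶)⁻¹)³)⁻¹·((1800L⁶)²·(2·((1+ρ₀²)∕ρ₀²)))`. [cite: Luscher1983, §2] [cite: Breitung1994, Lemma 26] -/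
theorem mbDensity_hubAt_comparable_rescaled {ε : GnoSign L} (hε : GoodSign ε) {δr δs δt ρ₀ : ℝ} (hδr : 1 ≤ δr) (hrs : δr ≤ δs) (hrt : δr ≤ δt)
    (hwin : 122689728 * δr⁻¹ * (L : ℝ) ^ 4 ≤ (2304 * (L : ℝ) ^ 6 * (Fintype.card (Fol L) : ℝ))⁻¹ / (2 * (3 * (Fintype.card (Fol L) : ℝ))))
    (hρ₀ : 0 < ρ₀) (p : ℝ × ℝ) (hp : ρ₀ ^ 2 ≤ p.1 ^ 2 + p.2 ^ 2) :
    mbDensity (L := L) (hubAt δt 1) ε p ≤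
      (Real.exp 1 * ((1 + (finrank ℝ (GnoFol L) : ℝ)) * (20400 * (L : ℝ) ^ 4)) ^ (7 / 2 : ℝ) *
          (Real.sqrt ((1 / 4 : ℝ) * (1 / (1800 * (L : ℝ) ^ 6))) ^ 3)⁻¹ * ((1800 * (L : ℝ) ^ 6) ^ 2 * (2 * ((1 + ρ₀ ^ 2) / ρ₀ ^ 2)))) *
        (1 + δt ^ 2) * mbDensity (L := L) (hubAt δs 1) ε p := by
  have hL : (0 : ℝ) < (L : ℝ) := Nat.cast_pos.2 (Nat.pos_of_ne_zero (NeZero.ne L))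
  have hδr0 : 0 < δr := by linarith
  have hδs0 : 0 < δs := by linarith
  have hδt0 : 0 < δt := by linarith
  have hδt1 : 1 ≤ δt := hδr.trans hrt
  have hp0 : 0 < p.1 ^ 2 + p.2 ^ 2 := lt_of_lt_of_le (by positivity) hp
  set μ : ℝ := (2304 * (L : ℝ) ^ 6 * (Fintype.card (Fol L) : ℝ))⁻¹ with hμ
  have hμ0 : 0 < μ := (folMu_pos_le (L := L)).1
  set N : ℝ := (Fintype.card (Fol L) : ℝ) with hN
  have hN3 : (3 : ℝ) ≤ N := by
    have h := nine_le_finrank_gnoFol (L := L)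
    rw [finrank_gnoFol_real] at h
    linarith
  -- dimensions (opaque)
  have hd9 := nine_le_finrank_gnoFol (L := L)
  obtain ⟨d, hd⟩ : ∃ d : ℝ, (finrank ℝ (GnoFol L) : ℝ) = d := ⟨_, rfl⟩
  rw [hd] at hd9 ⊢
  have hdpos : 0 < d := by linarith
  -- the hub angles `θ(δ) = π/2 − arctan δ`
  obtain ⟨hst2, hct2⟩ := sin_sq_cos_sq_hubAngle δt
  have hsint : 0 < Real.sin (Real.pi / 2 - Real.arctan δt) := sin_hubAngle_pos δt
  have hsins : 0 < Real.sin (Real.pi / 2 - Real.arctan δs) := sin_hubAngle_pos δs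
  have hcost : Real.cos (Real.pi / 2 - Real.arctan δt) ≠ 0 := by
    intro h
    have : Real.cos (Real.pi / 2 - Real.arctan δt) ^ 2 = 0 := by rw [h]; ring
    rw [hct2] at this
    exact absurd this (by positivity)
  -- the two follower families (at the hubs `hubAt δt 1`, `hubAt δs 1`)
  obtain ⟨At, hAts, -, hAtyy, hAtray, hAtamb, -, -⟩ := exists_gnoFolHessian (fun _ => false) (fun _ => (1 : SU2)) (hubAt_one_ne_zero δt) ε
  obtain ⟨As, hAss, -, hAsyy, hAsray, hAsamb, -, -⟩ := exists_gnoFolHessian (fun _ => false) (fun _ => (1 : SU2)) (hubAt_one_ne_zero δs) ε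
  set η₀ : GnoCoord L := gnoBase p.1 p.2 with hη₀
  set Dt : ℝ := Real.sqrt (LinearMap.det (At η₀)) with hDt
  set Ds : ℝ := Real.sqrt (LinearMap.det (As η₀)) with hDs
  have hdett : μ ^ finrank ℝ (GnoFol L) ≤ LinearMap.det (At η₀) := det_gnoFolHessian_base_ge (hubAt_one_ne_zero δt) ε hε.1 hε.2 p.1 p.2 hAts hAtray
  have hdets : μ ^ finrank ℝ (GnoFol L) ≤ LinearMap.det (As η₀) := det_gnoFolHessian_base_ge (hubAt_one_ne_zero δs) ε hε.1 hε.2 p.1 p.2 hAss hAsray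
  have hdett0 : 0 < LinearMap.det (At η₀) := lt_of_lt_of_le (by positivity) hdett
  have hdets0 : 0 < LinearMap.det (As η₀) := lt_of_lt_of_le (by positivity) hdets
  have hDt0 : 0 < Dt := Real.sqrt_pos.2 hdett0
  have hDs0 : 0 < Ds := Real.sqrt_pos.2 hdets0
  -- §T the rescaled tip ceiling at `hubAt δt 1 ~ angUnit θt`
  have hAtyy' : ∀ η (y : GnoFol L), ⟪At η y, y⟫_ℝ =
      iteratedFDeriv ℝ 2 (fun y' : GnoFol L => gnoDeficit (fun _ => false) (fun _ => 1) (angUnit (Real.pi / 2 - Real.arctan δt)) ε (η + gnoFolEmb y')) 0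
        (fun _ => y) := by
    intro η y
    rw [hAtyy η y]
    simp_rw [gnoDeficit_hubAt_eq_angUnit (fun _ => false) (fun _ => (1 : SU2)) δt ε]
  have hT := mbDensity_angUnit_le_floorDet_rescaled hcost hsint.ne' hε p hAts hAtyy'
  rw [mbDensity_angUnit_hubAngle] at hT
  -- §S the rescaled isotropic shell floor at `hubAt δs 1`
  have hres : (hubAt δs 1).re ≠ 0 := by rw [hubAt_one_re]; exact hδs0.ne'
  have hS := mbDensity_ge_detFol_rescaled' hres (hubAt_one_im_ne_zero δs) hε p hAss hAsyy
  rw [hd] at hS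
  -- §M the one-loop matching of the follower determinants at the base point
  have eθt : gnoDeficit (fun _ => false) (fun _ => (1 : SU2)) (hubAt δt 1) ε =
      gnoDeficit (fun _ => false) (fun _ => 1) (angUnit (Real.pi / 2 - Real.arctan δt)) ε :=
    funext fun η => gnoDeficit_hubAt_eq_angUnit _ _ δt ε η
  have eθs : gnoDeficit (fun _ => false) (fun _ => (1 : SU2)) (hubAt δs 1) ε =
      gnoDeficit (fun _ => false) (fun _ => 1) (angUnit (Real.pi / 2 - Real.arctan δs)) ε :=
    funext fun η => gnoDeficit_hubAt_eq_angUnit _ _ δs ε η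
  have hambt : ∀ η (y : GnoFol L), ⟪At η y, y⟫_ℝ =
      iteratedFDeriv ℝ 2 (gnoDeficit (fun _ => false) (fun _ => 1) (angUnit (Real.pi / 2 - Real.arctan δt)) ε) η (fun _ => gnoFolEmb y) :=
    fun η y => by rw [← eθt]; exact hAtamb η y
  have hambs : ∀ η (y : GnoFol L), ⟪As η y, y⟫_ℝ =
      iteratedFDeriv ℝ 2 (gnoDeficit (fun _ => false) (fun _ => 1) (angUnit (Real.pi / 2 - Real.arctan δs)) ε) η (fun _ => gnoFolEmb y) :=
    fun η y => by rw [← eθs]; exact hAsamb η y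
  have hθθ : |(Real.pi / 2 - Real.arctan δs) - (Real.pi / 2 - Real.arctan δt)| ≤ δr⁻¹ := abs_hubAngle_sub_le_inv hδr0 hrs hrt
  have hwin' : 122689728 * |(Real.pi / 2 - Real.arctan δs) - (Real.pi / 2 - Real.arctan δt)| * (L : ℝ) ^ 4 ≤ μ / (2 * (3 * N)) :=
    le_trans (by gcongr) hwin
  have hnear : (122689728 * |(Real.pi / 2 - Real.arctan δs) - (Real.pi / 2 - Real.arctan δt)| + 44712000 * ‖η₀ - η₀‖) * (L : ℝ) ^ 4 ≤ μ / 2 := by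
    rw [sub_self, norm_zero, mul_zero, add_zero]
    refine hwin'.trans ?_
    rw [div_le_div_iff₀ (by positivity) (by norm_num)]
    nlinarith
  have hlog := abs_log_det_gnoFolHessian_sub_le_joint (fun _ => false) (fun _ => (1 : SU2)) hsins.le hsint.le ε hAss hAts hambs hambt hμ0
    (gnoFolHessian_coercive_base (hubAt_one_ne_zero δt) ε hε.1 hε.2 p.1 p.2 hAtray) hnear
  rw [sub_self, norm_zero, mul_zero, add_zero] at hlog
  have hlog1 : Real.log (LinearMap.det (As η₀)) ≤ Real.log (LinearMap.det (At η₀)) + 1 := by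
    have h1 : 2 * (3 * N) * (122689728 * |(Real.pi / 2 - Real.arctan δs) - (Real.pi / 2 - Real.arctan δt)| * (L : ℝ) ^ 4) / μ ≤ 1 := by
      rw [div_le_one hμ0]
      calc 2 * (3 * N) * (122689728 * |(Real.pi / 2 - Real.arctan δs) - (Real.pi / 2 - Real.arctan δt)| * (L : ℝ) ^ 4)
          ≤ 2 * (3 * N) * (μ / (2 * (3 * N))) := by gcongr
        _ = μ := by field_simp
    have h2 := (abs_sub_le_iff.1 hlog).1
    linarith
  have hM : Ds ≤ Real.exp (1 / 2) * Dt := by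
    have h1 : LinearMap.det (As η₀) ≤ Real.exp 1 * LinearMap.det (At η₀) := by
      rw [← Real.exp_log hdets0, ← Real.exp_log hdett0, ← Real.exp_add, add_comm]
      exact Real.exp_le_exp.2 hlog1
    have h2 : Real.exp 1 = Real.exp (1 / 2) ^ 2 := by rw [← Real.exp_nat_mul]; norm_num
    calc Ds = Real.sqrt (LinearMap.det (As η₀)) := hDs
      _ ≤ Real.sqrt (Real.exp 1 * LinearMap.det (At η₀)) := Real.sqrt_le_sqrt h1
      _ = Real.exp (1 / 2) * Dt := by rw [Real.sqrt_mul (Real.exp_pos _).le, h2, Real.sqrt_sq (Real.exp_pos _).le, hDt]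
  -- §D the soft pair of the rescaled structured floor, uniform off the corner disc
  have hD := floorDetRescaled_ge (L := L) (Real.pi / 2 - Real.arctan δt) p hp
  set D : ℝ := ((1 / 4 : ℝ) * (16 * Real.cos (Real.pi / 2 - Real.arctan δt) ^ 2 * Real.sin (Real.pi / 2 - Real.arctan δt) ^ 2 /
          ((7200 * (L : ℝ) ^ 6) * (1 + p.1 ^ 2))) * Real.sqrt (1 + p.1 ^ 2) ^ 2) *
        ((1 / 4 : ℝ) * (4 * Real.sin (Real.pi / 2 - Real.arctan δt) ^ 2 / ((1800 * (L : ℝ) ^ 6) * (1 + p.2 ^ 2))) * Real.sqrt (1 + p.2 ^ 2) ^ 2) +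
      ((1 / 4 : ℝ) * (4 / ((1800 * (L : ℝ) ^ 6) * ((1 + p.1 ^ 2) * (1 + p.2 ^ 2))))) *
        (((1 / 4 : ℝ) * (16 * Real.cos (Real.pi / 2 - Real.arctan δt) ^ 2 * Real.sin (Real.pi / 2 - Real.arctan δt) ^ 2 /
            ((7200 * (L : ℝ) ^ 6) * (1 + p.1 ^ 2))) * Real.sqrt (1 + p.1 ^ 2) ^ 2) * (p.1 * Real.sqrt (1 + p.2 ^ 2)) ^ 2 +
          ((1 / 4 : ℝ) * (4 * Real.sin (Real.pi / 2 - Real.arctan δt) ^ 2 / ((1800 * (L : ℝ) ^ 6) * (1 + p.2 ^ 2))) * Real.sqrt (1 + p.2 ^ 2) ^ 2) *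
            (Real.sqrt (1 + p.1 ^ 2) * p.2) ^ 2) with hDdef
  have hcs : Real.cos (Real.pi / 2 - Real.arctan δt) ^ 2 * Real.sin (Real.pi / 2 - Real.arctan δt) ^ 2 = δt ^ 2 / (1 + δt ^ 2) ^ 2 := by
    rw [hct2, hst2]; field_simp
  rw [hcs] at hD
  have hq0 : 0 < ρ₀ ^ 2 / (1 + ρ₀ ^ 2) := by positivity
  have hD0 : 0 < D := lt_of_lt_of_le (by positivity) hD
  set Z : ℝ := Real.sqrt ((1 / 4 : ℝ) * (1 / (1800 * (L : ℝ) ^ 6))) ^ 3 with hZ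
  have hZ0 : 0 < Z := by rw [hZ]; positivity
  set ρb : ℝ := gnoDensity (gnoBase p.1 p.2 : GnoCoord L) with hρb
  have hρb0 : 0 < ρb := gnoDensity_pos _
  set J : ℝ := (1 + p.1 ^ 2) * (1 + p.2 ^ 2) with hJ
  have hJ0 : 0 < J := by rw [hJ]; positivity
  have hJac : ρb * J = (1 + p.1 ^ 2)⁻¹ * (1 + p.2 ^ 2)⁻¹ := by rw [hρb, hJ]; exact gnoDensity_gnoBase_mul_jacobian p
  set K2 : ℝ := (1800 * (L : ℝ) ^ 6) ^ 2 with hK2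
  have hK20 : 0 < K2 := by rw [hK2]; positivity
  have hDinv : 1 / D ≤ K2 * (2 * (1 + δt ^ 2)) / (ρ₀ ^ 2 / (1 + ρ₀ ^ 2)) := by
    have h2 : (1 + δt ^ 2) ^ 2 / δt ^ 2 ≤ 2 * (1 + δt ^ 2) := by
      rw [div_le_iff₀ (by positivity)]
      have hx : 1 ≤ δt ^ 2 := by nlinarith
      have hprod : 0 ≤ (1 + δt ^ 2) * (δt ^ 2 - 1) := mul_nonneg (by positivity) (by linarith)
      nlinarith [hprod]
    rw [div_le_div_iff₀ hD0 hq0, one_mul]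
    have h3 : ρ₀ ^ 2 / (1 + ρ₀ ^ 2) ≤ D * K2 * ((1 + δt ^ 2) ^ 2 / δt ^ 2) := by
      have h1' := (div_le_iff₀ hK20).1 hD
      have e : δt ^ 2 / (1 + δt ^ 2) ^ 2 * (ρ₀ ^ 2 / (1 + ρ₀ ^ 2)) * ((1 + δt ^ 2) ^ 2 / δt ^ 2) = ρ₀ ^ 2 / (1 + ρ₀ ^ 2) := by
        field_simp
      calc ρ₀ ^ 2 / (1 + ρ₀ ^ 2) = δt ^ 2 / (1 + δt ^ 2) ^ 2 * (ρ₀ ^ 2 / (1 + ρ₀ ^ 2)) * ((1 + δt ^ 2) ^ 2 / δt ^ 2) := e.symm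
        _ ≤ D * K2 * ((1 + δt ^ 2) ^ 2 / δt ^ 2) := by gcongr
    calc ρ₀ ^ 2 / (1 + ρ₀ ^ 2) ≤ D * K2 * ((1 + δt ^ 2) ^ 2 / δt ^ 2) := h3
      _ ≤ D * K2 * (2 * (1 + δt ^ 2)) := by gcongr
      _ = K2 * (2 * (1 + δt ^ 2)) * D := by ring
  -- §A assembly
  set C7 : ℝ := ((1 + d) * (20400 * (L : ℝ) ^ 4)) ^ (-(7 / 2 : ℝ)) with hC7
  have hC70 : 0 < C7 := by rw [hC7]; exact Real.rpow_pos_of_pos (by positivity) _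
  have hC7inv : C7⁻¹ = ((1 + d) * (20400 * (L : ℝ) ^ 4)) ^ (7 / 2 : ℝ) := by
    rw [hC7, Real.rpow_neg (by positivity), inv_inv]
  -- (S) in product form: `ρb·J ≤ ms · Ds · e^{1/2}/C7`
  have hS' : (1 + p.1 ^ 2)⁻¹ * (1 + p.2 ^ 2)⁻¹ * (C7 * Real.exp (-(1 / 2 : ℝ)) / Ds) ≤ mbDensity (L := L) (hubAt δs 1) ε p := hS
  rw [← hJac] at hS'
  have hms0 : 0 ≤ mbDensity (L := L) (hubAt δs 1) ε p := le_trans (by positivity) hS'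
  have hexp : Real.exp (-(1 / 2 : ℝ)) = (Real.exp (1 / 2))⁻¹ := by rw [Real.exp_neg]
  have hρJ : ρb * J ≤ mbDensity (L := L) (hubAt δs 1) ε p * (Ds * Real.exp (1 / 2) / C7) := by
    have e : ρb * J * (C7 * Real.exp (-(1 / 2 : ℝ)) / Ds) * (Ds * Real.exp (1 / 2) / C7) = ρb * J := by
      rw [hexp]; field_simp
    rw [← e]
    exact mul_le_mul_of_nonneg_right hS' (by positivity)
  -- (T): `mt ≤ ρb J/(Z D Dt)`
  have hT' : mbDensity (L := L) (hubAt δt 1) ε p ≤ ρb * J / (Z * D * Dt) := hT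
  calc mbDensity (L := L) (hubAt δt 1) ε p ≤ ρb * J / (Z * D * Dt) := hT'
    _ ≤ mbDensity (L := L) (hubAt δs 1) ε p * (Ds * Real.exp (1 / 2) / C7) / (Z * D * Dt) := by gcongr
    _ = mbDensity (L := L) (hubAt δs 1) ε p * (Ds / Dt) * Real.exp (1 / 2) / C7 * (1 / D) / Z := by field_simp
    _ ≤ mbDensity (L := L) (hubAt δs 1) ε p * Real.exp (1 / 2) * Real.exp (1 / 2) / C7 * (K2 * (2 * (1 + δt ^ 2)) / (ρ₀ ^ 2 / (1 + ρ₀ ^ 2))) / Z := by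
        have h1 : Ds / Dt ≤ Real.exp (1 / 2) := (div_le_iff₀ hDt0).2 hM
        gcongr
    _ = (Real.exp (1 / 2) * Real.exp (1 / 2) * C7⁻¹ * Z⁻¹ * (K2 * (2 * ((1 + ρ₀ ^ 2) / ρ₀ ^ 2)))) * (1 + δt ^ 2) * mbDensity (L := L) (hubAt δs 1) ε p := by
        field_simp
    _ = _ := by rw [← Real.exp_add, show (1 / 2 : ℝ) + 1 / 2 = 1 by norm_num, hC7inv, hZ, hK2]

end Summit.QuantumFields.YangMills.Theorems.SwapVirialDeficit.SectorLaplace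

end
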